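import Summits.Ventures.WeilGRH.TwistedGramOddReal
import Summits.Ventures.WeilGRH.TwistedGramEvenComplex
import HarnessLib

/-!
# GRH arm (rh-explicit, venture WeilGRH): the Gram matrix of an ODD character with COMPLEX values on
  Yoshida's windows — the last assembly (shift pairings + `sech` block)

Cell `rh-explicit`, WEIL TRACK — GRH ARM (typing seat weil-grh-1).  Sequel of `TwistedGramEvenComplex.lean`
(shift-pairing entries `shiftCoeff`, hermitian kernel `twistedGramCoeffC`) and `TwistedGramOddReal.lean` (the
`sech` block `sechIncrCoeff` of the parity bonus).  For a character of ODD parity (`a_χ = 1`) and arbitrary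
values — the 29 odd non-real primitive characters of conductor `≤ 20` (`5.2/5.3`, `7.3/7.5`, `9.2/9.5`,
`11.2/…`, `13.2/…`, `16.3/16.11`, …) — on window functions

  `𝓔^χ_a(u) − M^χ_a‖u‖₂² = [weilWindowForm a u − P(u)] + 2Σ_{log k<2a} Λ(k)k^{-1/2} Re((1 − χ(k)) h_u(log k))`
      `+ (log q)‖u‖₂² + (π‖u‖₂² − ∫₀^∞ D_t(u) dt/(2cosh(t/2)))`           (`twistedWindowForm_eq_of_odd`)

(`h_u(t) = ∫ u(x+t) conj u(x) dx`), and on the trigonometric windows the ENTRY THEOREM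

  `𝓔^χ_a(Σ c_nχ_n) − M^χ_a‖Σ c_nχ_n‖₂² = Σ_n Σ_m Re(conj c_n · c_m · twistedGramCoeffOddC χ a n m)`,
  `twistedGramCoeffOddC χ a n m = twistedGramCoeffC χ a n m + (π δ_{nm} − sechIncrCoeff a n m)`

(`twistedWindowForm_sum_smul_chi_eq_twistedGramCoeffOddC`), with the hermitian-PSD interface
`weilPositivityOnChar_of_twistedGramCoeffOddC_psd`.  Together with the even / real files, EVERY Dirichlet
character now has a typed Gram object on Yoshida's windows whose positive semidefiniteness for all `N` is a
`WeilPositivityOnChar χ a` theorem.  One definition (docstring'd); no named facts; RH/GRH-free.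
-/

set_option autoImplicit false

noncomputable section

open Complex Filter Set MeasureTheory
open scoped Real Topology ComplexConjugate ArithmeticFunction.vonMangoldt

namespace Summit.Ventures.WeilGRH

open Literature.NumberTheory.LFunctions
open Literature.NumberTheory.LFunctions.Yoshida1992 (modes chi freq gramCoeff polarCoeff incrCoeff)
open Summit.RiemannHypothesis.RiemannHypothesis.Theorems.WeilFormatC

variable {q : ℕ} {a S Le : ℝ} {u : ℝ → ℂ}

/-! ## The window-level identity for an odd character -/

/-- **The twisted window form of an ODD character (complex values) through the `ζ` window form, the shift
pairing and the `sech` bonus**: for `a_χ = 1`, `0 ≤ a` and a window function `u`. -/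
theorem twistedWindowForm_eq_of_odd (χ : DirichletCharacter ℂ q) (hodd : charParity χ = 1) (ha : 0 ≤ a)
    (hm : Measurable u) (hz : ∀ x, x ∉ Icc (-a) a → u x = 0) (hb : ∀ x, ‖u x‖ ≤ S)
    (hl : ∀ x y, x ∈ Icc (-a) a → y ∈ Icc (-a) a → ‖u y - u x‖ ≤ Le * |y - x|) :
    weilDirichletEnergyChar χ a u - weilMarkovConstantChar χ a * ∫ x, ‖u x‖ ^ 2 =
      weilWindowForm a u - weilPoleForm u +
        2 * (∑ k ∈ weilPrimeIndex a, (Λ k : ℝ) / Real.sqrt k *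
          ((1 - χ (k : ZMod q)) * ∫ x, u (x + Real.log k) * conj (u x)).re) +
        Real.log q * (∫ x, ‖u x‖ ^ 2) +
        (π * (∫ x, ‖u x‖ ^ 2) - ∫ t in Ioi (0 : ℝ), 1 / (2 * Real.cosh (t / 2)) * weilIncrement u t) := by
  have htw : ∀ k : ℕ, weilTwistIncrement (conj (χ (k : ZMod q))) u (Real.log k) =
      (1 + ‖χ (k : ZMod q)‖ ^ 2) * (∫ x, ‖u x‖ ^ 2) -
        2 * (χ (k : ZMod q) * ∫ x, u (x + Real.log k) * conj (u x)).re := fun k ↦ by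
    rw [weilTwistIncrement_eq_of_window hm hz hb, Complex.norm_conj, Complex.conj_conj]
  have hpl : ∀ k : ℕ, weilIncrement u (Real.log k) =
      2 * (∫ x, ‖u x‖ ^ 2) - 2 * (∫ x, u (x + Real.log k) * conj (u x)).re := fun k ↦ by
    have h := weilTwistIncrement_eq_of_window hm hz hb 1 (Real.log k)
    rw [show weilTwistIncrement 1 u (Real.log k) = weilIncrement u (Real.log k) by
      simp [weilTwistIncrement, weilIncrement], map_one, one_mul, norm_one] at h
    rw [h]; ring
  have hre : ∀ k : ℕ, ((1 - χ (k : ZMod q)) * ∫ x, u (x + Real.log k) * conj (u x)).re =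
      (∫ x, u (x + Real.log k) * conj (u x)).re -
        (χ (k : ZMod q) * ∫ x, u (x + Real.log k) * conj (u x)).re := by
    intro k; rw [sub_mul, one_mul, Complex.sub_re]
  have hIρ := integrableOn_weilArchDensity_mul_weilIncrement_window ha hm hz hb hl
  have hIσ := integrableOn_sech_mul_weilIncrement ha hm hz hb
  have harch : ∫ t in Ioi (0 : ℝ), weilArchDensityPar 1 t * weilIncrement u t =
      (∫ t in Ioi (0 : ℝ), weilArchDensity t * weilIncrement u t) -
        ∫ t in Ioi (0 : ℝ), 1 / (2 * Real.cosh (t / 2)) * weilIncrement u t := by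
    rw [← integral_sub hIρ hIσ]
    refine setIntegral_congr_fun measurableSet_Ioi fun t (ht : 0 < t) ↦ ?_
    rw [weilArchDensityPar_one_eq ht.ne', sub_mul]
  have hkill : ∫ t in Ioi (0 : ℝ), weilKillingDensityPar 1 t =
      (∫ t in Ioi (0 : ℝ), (Real.exp (t / 2) - 1) / (2 * Real.sinh t)) - π / 2 := by
    rw [← integral_sech_density_Ioi_zero, ← integral_sub integrableOn_weilKillingDensity
      (integrableOn_sech_density_Ioi 0)]
    exact setIntegral_congr_fun measurableSet_Ioi fun t (ht : 0 < t) ↦ weilKillingDensityPar_one_eq ht.ne'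
  unfold weilDirichletEnergyChar weilMarkovConstantChar weilWindowForm weilDirichletEnergy weilMarkovConstant
  rw [hodd, harch, hkill]
  simp_rw [htw, hpl, hre]
  set N2 : ℝ := ∫ x, ‖u x‖ ^ 2
  have h1 : ∑ k ∈ weilPrimeIndex a, (Λ k : ℝ) / Real.sqrt k *
      ((1 + ‖χ (k : ZMod q)‖ ^ 2) * N2 - 2 * (χ (k : ZMod q) * ∫ x, u (x + Real.log k) * conj (u x)).re) =
      N2 * (∑ k ∈ weilPrimeIndex a, (Λ k : ℝ) / Real.sqrt k * (1 + ‖χ (k : ZMod q)‖ ^ 2)) -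
        2 * ∑ k ∈ weilPrimeIndex a, (Λ k : ℝ) / Real.sqrt k *
          (χ (k : ZMod q) * ∫ x, u (x + Real.log k) * conj (u x)).re := by
    rw [Finset.mul_sum, Finset.mul_sum, ← Finset.sum_sub_distrib]
    exact Finset.sum_congr rfl fun k _ ↦ by ring
  have h2 : ∑ k ∈ weilPrimeIndex a, (Λ k : ℝ) / Real.sqrt k *
      (2 * N2 - 2 * (∫ x, u (x + Real.log k) * conj (u x)).re) =
      2 * N2 * (∑ k ∈ weilPrimeIndex a, (Λ k : ℝ) / Real.sqrt k) -
        2 * ∑ k ∈ weilPrimeIndex a, (Λ k : ℝ) / Real.sqrt k * (∫ x, u (x + Real.log k) * conj (u x)).re := by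
    rw [Finset.mul_sum, Finset.mul_sum, ← Finset.sum_sub_distrib]
    exact Finset.sum_congr rfl fun k _ ↦ by ring
  have h3 : ∑ k ∈ weilPrimeIndex a, (Λ k : ℝ) / Real.sqrt k *
      ((∫ x, u (x + Real.log k) * conj (u x)).re -
        (χ (k : ZMod q) * ∫ x, u (x + Real.log k) * conj (u x)).re) =
      (∑ k ∈ weilPrimeIndex a, (Λ k : ℝ) / Real.sqrt k * (∫ x, u (x + Real.log k) * conj (u x)).re) -
        ∑ k ∈ weilPrimeIndex a, (Λ k : ℝ) / Real.sqrt k *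
          (χ (k : ZMod q) * ∫ x, u (x + Real.log k) * conj (u x)).re := by
    rw [← Finset.sum_sub_distrib]
    exact Finset.sum_congr rfl fun k _ ↦ by ring
  rw [h1, h2, h3]
  ring

/-! ## The parity-free complex core on the trigonometric windows -/

section Pairing

variable (s : Finset ℤ) (c : ℤ → ℂ)

/-- The real pairing against `z·P(m,n) + conj(z·P(n,m))` is `2 Re(z Σ_m Σ_n c_m conj(c_n) P(m,n))`. -/
private theorem sum_sum_re_herm' (z : ℂ) (P : ℤ → ℤ → ℂ) :
    ∑ n ∈ s, ∑ m ∈ s, (conj (c n) * c m * (z * P m n + conj (z * P n m))).re =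
      2 * (z * ∑ m ∈ s, ∑ n ∈ s, c m * conj (c n) * P m n).re := by
  have hA : ∑ n ∈ s, ∑ m ∈ s, (conj (c n) * c m * (z * P m n)).re =
      (z * ∑ m ∈ s, ∑ n ∈ s, c m * conj (c n) * P m n).re := by
    rw [Finset.sum_comm]
    simp only [Finset.mul_sum, Complex.re_sum]
    refine Finset.sum_congr rfl fun m _ ↦ Finset.sum_congr rfl fun n _ ↦ ?_
    congr 1
    ring
  have hB : ∑ n ∈ s, ∑ m ∈ s, (conj (c n) * c m * conj (z * P n m)).re =
      (z * ∑ m ∈ s, ∑ n ∈ s, c m * conj (c n) * P m n).re := by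
    simp only [Finset.mul_sum, Complex.re_sum]
    refine Finset.sum_congr rfl fun n _ ↦ Finset.sum_congr rfl fun m _ ↦ ?_
    rw [show conj (c n) * c m * conj (z * P n m) = conj (z * (c n * conj (c m) * P n m)) by
      simp only [map_mul, Complex.conj_conj]; ring, Complex.conj_re]
  simp only [mul_add, Complex.add_re, Finset.sum_add_distrib]
  rw [hA, hB]
  ring

/-- Three finite sums commute. -/
private theorem sum_sum_sum_comm' (t : Finset ℕ) (f : ℕ → ℤ → ℤ → ℝ) :
    ∑ n ∈ s, ∑ m ∈ s, ∑ k ∈ t, f k n m = ∑ k ∈ t, ∑ n ∈ s, ∑ m ∈ s, f k n m := by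
  calc ∑ n ∈ s, ∑ m ∈ s, ∑ k ∈ t, f k n m
      = ∑ n ∈ s, ∑ k ∈ t, ∑ m ∈ s, f k n m := Finset.sum_congr rfl fun n _ ↦ Finset.sum_comm
    _ = ∑ k ∈ t, ∑ n ∈ s, ∑ m ∈ s, f k n m := Finset.sum_comm

end Pairing

/-- **The parity-free complex core on the trigonometric windows**: for ANY Dirichlet character `χ`, `a > 0`,
`[weilWindowForm a u − P(u)] + 2Σ_{log k<2a}Λ(k)k^{-1/2}Re((1 − χ(k))h_u(log k)) + (log q)‖u‖₂²` at `u = Σ c_nχ_n`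
equals `Σ_n Σ_m Re(conj c_n · c_m · twistedGramCoeffC χ a n m)`. -/
theorem coreC_sum_smul_chi_eq_twistedGramCoeffC (χ : DirichletCharacter ℂ q) (ha : 0 < a) (s : Finset ℤ)
    (c : ℤ → ℂ) :
    weilWindowForm a (∑ n ∈ s, c n • chi a n) - weilPoleForm (∑ n ∈ s, c n • chi a n) +
        2 * (∑ k ∈ weilPrimeIndex a, (Λ k : ℝ) / Real.sqrt k *
          ((1 - χ (k : ZMod q)) * ∫ x, (∑ n ∈ s, c n • chi a n) (x + Real.log k) *
            conj ((∑ n ∈ s, c n • chi a n) x)).re) +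
        Real.log q * ∫ x, ‖(∑ n ∈ s, c n • chi a n) x‖ ^ 2 =
      ∑ n ∈ s, ∑ m ∈ s, (conj (c n) * c m * twistedGramCoeffC χ a n m).re := by
  rw [weilWindowForm_sum_smul_chi_eq_gramCoeff ha, weilPoleForm_sum_smul_chi ha,
    integral_norm_sq_sum_smul_chi' ha]
  have hk : ∀ k ∈ weilPrimeIndex a, 0 ≤ Real.log k ∧ Real.log k ≤ 2 * a := fun k hk ↦
    ⟨Real.log_natCast_nonneg k, (mem_weilPrimeIndex.1 hk).le⟩
  have hP : (∑ n ∈ s, ∑ m ∈ s, (conj (c n) * c m).re *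
      ((-1 : ℝ) ^ (n + m) * (4 / a) * (Real.exp (a / 2) - Real.exp (-(a / 2))) ^ 2 *
        (1 - 4 * (π * n / a) * (π * m / a)) / ((1 + 4 * (π * n / a) ^ 2) * (1 + 4 * (π * m / a) ^ 2)))) =
      ∑ n ∈ s, ∑ m ∈ s, (conj (c n) * c m).re * polarCoeff a n m := rfl
  set S : ℕ → ℂ := fun k ↦ ∑ m ∈ s, ∑ n ∈ s, c m * conj (c n) * shiftCoeff a (Real.log k) m n with hSdef
  have hSsum : (∑ k ∈ weilPrimeIndex a, (Λ k : ℝ) / Real.sqrt k *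
      ((1 - χ (k : ZMod q)) * ∫ x, (∑ n ∈ s, c n • chi a n) (x + Real.log k) *
        conj ((∑ n ∈ s, c n • chi a n) x)).re) =
      ∑ k ∈ weilPrimeIndex a, (Λ k : ℝ) / Real.sqrt k * ((1 - χ (k : ZMod q)) * S k).re := by
    refine Finset.sum_congr rfl fun k hk' ↦ ?_
    rw [integral_shift_mul_conj_sum_smul_chi ha s c (hk k hk').1 (hk k hk').2]
  rw [hP, hSsum]
  have e : ∀ n m : ℤ, (conj (c n) * c m * twistedGramCoeffC χ a n m).re =
      ((conj (c n) * c m).re * gramCoeff a n m - (conj (c n) * c m).re * polarCoeff a n m +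
          (conj (c n) * c m).re * (if n = m then Real.log q else 0)) +
        ∑ k ∈ weilPrimeIndex a, (Λ k : ℝ) / Real.sqrt k *
          (conj (c n) * c m * ((1 - χ (k : ZMod q)) * shiftCoeff a (Real.log k) m n +
            conj ((1 - χ (k : ZMod q)) * shiftCoeff a (Real.log k) n m))).re := by
    intro n m
    unfold twistedGramCoeffC
    rw [mul_add, Complex.add_re, Complex.re_mul_ofReal, Finset.mul_sum, Complex.re_sum]
    congr 1
    · ring
    · refine Finset.sum_congr rfl fun k _ ↦ ?_
      rw [show conj (c n) * c m * ((((Λ k : ℝ) / Real.sqrt k : ℝ) : ℂ) *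
          ((1 - χ (k : ZMod q)) * shiftCoeff a (Real.log k) m n +
            conj ((1 - χ (k : ZMod q)) * shiftCoeff a (Real.log k) n m))) =
          (((Λ k : ℝ) / Real.sqrt k : ℝ) : ℂ) * (conj (c n) * c m *
            ((1 - χ (k : ZMod q)) * shiftCoeff a (Real.log k) m n +
              conj ((1 - χ (k : ZMod q)) * shiftCoeff a (Real.log k) n m))) by ring,
        Complex.re_ofReal_mul]
  have hR : ∑ n ∈ s, ∑ m ∈ s, (conj (c n) * c m * twistedGramCoeffC χ a n m).re =
      (∑ n ∈ s, ∑ m ∈ s, (conj (c n) * c m).re * gramCoeff a n m) -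
        (∑ n ∈ s, ∑ m ∈ s, (conj (c n) * c m).re * polarCoeff a n m) +
        (∑ n ∈ s, ∑ m ∈ s, (conj (c n) * c m).re * (if n = m then Real.log q else 0)) +
        ∑ k ∈ weilPrimeIndex a, (Λ k : ℝ) / Real.sqrt k *
          ∑ n ∈ s, ∑ m ∈ s, (conj (c n) * c m * ((1 - χ (k : ZMod q)) * shiftCoeff a (Real.log k) m n +
            conj ((1 - χ (k : ZMod q)) * shiftCoeff a (Real.log k) n m))).re := by
    rw [Finset.sum_congr rfl fun n _ ↦ Finset.sum_congr rfl fun m _ ↦ e n m]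
    simp only [Finset.sum_add_distrib, Finset.sum_sub_distrib]
    congr 1
    rw [sum_sum_sum_comm']
    refine Finset.sum_congr rfl fun k _ ↦ ?_
    rw [Finset.mul_sum]
    refine Finset.sum_congr rfl fun n _ ↦ ?_
    rw [Finset.mul_sum]
  have hherm : ∀ k : ℕ, ∑ n ∈ s, ∑ m ∈ s, (conj (c n) * c m *
      ((1 - χ (k : ZMod q)) * shiftCoeff a (Real.log k) m n +
        conj ((1 - χ (k : ZMod q)) * shiftCoeff a (Real.log k) n m))).re =
      2 * ((1 - χ (k : ZMod q)) * S k).re := fun k ↦ by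
    rw [sum_sum_re_herm']
  have hQ : ∑ n ∈ s, ∑ m ∈ s, (conj (c n) * c m).re * (if n = m then Real.log q else 0) =
      Real.log q * ∑ n ∈ s, ∑ m ∈ s, (conj (c n) * c m).re * (if n = m then (1 : ℝ) else 0) := by
    rw [Finset.mul_sum]
    refine Finset.sum_congr rfl fun n _ ↦ ?_
    rw [Finset.mul_sum]
    refine Finset.sum_congr rfl fun m _ ↦ ?_
    split_ifs <;> ring
  have h2 : ∑ k ∈ weilPrimeIndex a, (Λ k : ℝ) / Real.sqrt k * (2 * ((1 - χ (k : ZMod q)) * S k).re) =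
      2 * ∑ k ∈ weilPrimeIndex a, (Λ k : ℝ) / Real.sqrt k * ((1 - χ (k : ZMod q)) * S k).re := by
    rw [Finset.mul_sum]
    exact Finset.sum_congr rfl fun k _ ↦ by ring
  rw [hR]
  simp_rw [hherm]
  rw [hQ, h2]
  ring

/-! ## The Gram kernel of an odd character and the entry theorem -/

/-- **The hermitian Gram kernel of an ODD character on Yoshida's basis**:
`G^χ_oddC(n,m) = twistedGramCoeffC χ a n m + (π δ_{nm} − sechIncrCoeff a n m)` (the even-parity kernel plus the
parity bonus block).  It IS the matrix of the twisted window form for `a_χ = 1`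
(`twistedWindowForm_sum_smul_chi_eq_twistedGramCoeffOddC`). -/
def twistedGramCoeffOddC (χ : DirichletCharacter ℂ q) (a : ℝ) (n m : ℤ) : ℂ :=
  twistedGramCoeffC χ a n m + (((if n = m then π else 0) - sechIncrCoeff a n m : ℝ) : ℂ)

/-- Hermitian symmetry: `G^χ_oddC(m,n) = conj G^χ_oddC(n,m)`. -/
theorem twistedGramCoeffOddC_conj_symm (χ : DirichletCharacter ℂ q) (a : ℝ) (n m : ℤ) :
    twistedGramCoeffOddC χ a m n = conj (twistedGramCoeffOddC χ a n m) := by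
  unfold twistedGramCoeffOddC
  rw [map_add, Complex.conj_ofReal, ← twistedGramCoeffC_conj_symm, sechIncrCoeff_comm a m n]
  by_cases h : m = n
  · subst h; rfl
  · rw [if_neg h, if_neg (Ne.symm h)]

/-- **ENTRY THEOREM for an odd character (complex values allowed)**: for `a_χ = 1`, `a > 0`,
`𝓔^χ_a(Σ c_nχ_n) − M^χ_a‖Σ c_nχ_n‖₂² = Σ_n Σ_m Re(conj c_n · c_m · twistedGramCoeffOddC χ a n m)`. -/
theorem twistedWindowForm_sum_smul_chi_eq_twistedGramCoeffOddC (χ : DirichletCharacter ℂ q)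
    (hodd : charParity χ = 1) (ha : 0 < a) (s : Finset ℤ) (c : ℤ → ℂ) :
    weilDirichletEnergyChar χ a (∑ n ∈ s, c n • chi a n) -
        weilMarkovConstantChar χ a * ∫ x, ‖(∑ n ∈ s, c n • chi a n) x‖ ^ 2 =
      ∑ n ∈ s, ∑ m ∈ s, (conj (c n) * c m * twistedGramCoeffOddC χ a n m).re := by
  rw [twistedWindowForm_eq_of_odd χ hodd ha.le (measurable_sum_smul_chi _ _)
    (fun x hx ↦ sum_smul_chi_eq_zero _ _ hx) (fun x ↦ norm_sum_smul_chi_le _ _ x)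
    (fun x y hx hy ↦ norm_sum_smul_chi_sub_le ha _ _ hx hy),
    coreC_sum_smul_chi_eq_twistedGramCoeffC χ ha s c, setIntegral_sech_mul_weilIncrement_sum_smul_chi ha s c,
    integral_norm_sq_sum_smul_chi' ha]
  have e : ∀ n m : ℤ, (conj (c n) * c m * twistedGramCoeffOddC χ a n m).re =
      (conj (c n) * c m * twistedGramCoeffC χ a n m).re +
        ((conj (c n) * c m).re * (if n = m then π else 0) - (conj (c n) * c m).re * sechIncrCoeff a n m) := by
    intro n m
    unfold twistedGramCoeffOddC
    rw [mul_add, Complex.add_re, Complex.re_mul_ofReal, mul_sub]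
  simp_rw [e]
  simp only [Finset.sum_add_distrib, Finset.sum_sub_distrib]
  have hπ : ∑ n ∈ s, ∑ m ∈ s, (conj (c n) * c m).re * (if n = m then π else 0) =
      π * ∑ n ∈ s, ∑ m ∈ s, (conj (c n) * c m).re * (if n = m then (1 : ℝ) else 0) := by
    rw [Finset.mul_sum]
    refine Finset.sum_congr rfl fun n _ ↦ ?_
    rw [Finset.mul_sum]
    refine Finset.sum_congr rfl fun m _ ↦ ?_
    split_ifs <;> ring
  rw [hπ]

/-- **A hermitian PSD certificate of `twistedGramCoeffOddC χ a` on every `modes N` gives the rung**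
(`q ≠ 1`, `a > 0`, `a_χ = 1`). -/
theorem weilPositivityOnChar_of_twistedGramCoeffOddC_psd (hq : q ≠ 1) (χ : DirichletCharacter ℂ q)
    (hodd : charParity χ = 1) (ha : 0 < a)
    (hpsd : ∀ (N : ℕ) (c : ℤ → ℂ),
      0 ≤ ∑ n ∈ modes N, ∑ m ∈ modes N, (conj (c n) * c m * twistedGramCoeffOddC χ a n m).re) :
    WeilPositivityOnChar χ a :=
  weilPositivityOnChar_of_twistedWindowForm_sum_chi_nonneg hq χ ha fun N c ↦ by
    rw [twistedWindowForm_sum_smul_chi_eq_twistedGramCoeffOddC χ hodd ha]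
    exact hpsd N c

end Summit.Ventures.WeilGRH

end
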